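import Summits.AtomisticToContinuum.HydrodynamicLimit.Theorems.CollisionIsometryCLTCollisionalTransferLocalityDefsE
import Summits.AtomisticToContinuum.HydrodynamicLimit.Theorems.CollisionIsometryCLTCollisionalTransferLocalityDefsD
import Summits.AtomisticToContinuum.HydrodynamicLimit.Theorems.CollisionIsometryCLTCollisionalTransferLocalityGridReduction
import Summits.AtomisticToContinuum.HydrodynamicLimit.Theorems.CollisionIsometryCLTCollisionalTransferLocalityEnergyAllTimes
import Summits.AtomisticToContinuum.HydrodynamicLimit.Theorems.CollisionIsometryCLTCollisionalTransferLocalityCompressibilityLinear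
import Summits.AtomisticToContinuum.HydrodynamicLimit.Theorems.CollisionIsometryCLTCollisionalTransferLocalityBlockFields
import HarnessLib

/-!
# [SupA] The `sup_τ` momentum law from the fixed-time laws (stub `stub_collisionalStressLaw_of_fixedA`)
(line `hemisphere-affine-slaving`, crux `CollisionalTransferLocality`, stmt-AtomisticToContinuum-9518)

Supporting file (`--supports stmt-AtomisticToContinuum-9518`) proving the registered assembly stub [SupA]
`stub_collisionalStressLaw_of_fixedA` VERBATIM: the three statements [KσA] (the fixed-time momentum law
`StressLawFixedAAt` for every smooth matrix weight `A`), [EnvA] (the deterministic Lipschitz envelope of the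
value `RhsA + KfunA` on dilute good orbits under the energy cap) and [DomA] (the isotropic mark sum
`MfunA σ Φ isoW` is monotone and dominates the increments of `MfunA σ Φ A` for bounded `A`) imply
`CollisionalStressLaw` (…DefsD), the momentum-channel engine statement uniformly in `τ ≤ t`.

## Proof (probability assembly; pattern of `stub_equilibriumSup`, file …EquilibriumSup)

Given nice profiles take `σ_A, η_A` from [KσA], `η_Z, K` from [Z] `stub_hsCompressibility_linear`, and answer
`σ₀ := min σ_A (1/2)`, `η₁ := min η_A η_Z`. At `(σ, Φ, t, [V], kernel, DiluteAt η₁, ψ, δ)`: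
* the energy cap `E₀` of [E] `stub_energyAllTimes`, a gradient bound `C_ψ` of `∇ψ` on `[0, t] × 𝕋³`
  (`exists_grad_bound`), the Lipschitz constants `L_ψ` ([EnvA] at `C_A := C_ψ`) and `L₁` ([EnvA] at `C_A := 1`);
* [KσA] at `A := ∇ψ` (`smoothMatrixOn_gradPsi`) and at `A := 𝟙 = isoW` (`smoothMatrixOn_isoW`), at the
  dilute level `η_A ≥ η₁` (`DiluteAt` is monotone in the level), evaluated at the `n + 1` grid times `kt/n`: `2(n+1)`
  events of probability `→ 0` at accuracy `δ' := δ/(4(1 + 18 C_ψ))`, with `n` so large that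
  `(9 C_ψ L₁ + L_ψ) t/n < δ/4`;
* DETERMINISTIC CORE (`supBound_of_grid_SF`) on a good orbit off the energy event, the dilute event and the
  grid events: with `J := MfunA (∇ψ)`, `V := MfunA 𝟙` (monotone, [DomA]), `R := RhsA (∇ψ) + KfunA (∇ψ)`
  (modulus `L_ψ t/n`, [EnvA]) and `|J(τ') − J(τ)| ≤ 9 C_ψ (V(τ') − V(τ))` ([DomA]), the grid lemma
  `exists_grid_index_of_dominated_increments` gives
  `|J(τ) − R(τ)| ≤ δ' + 9 C_ψ (V(τ_{k+1}) − V(τ_k)) + L_ψ t/n`, and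
  `V(τ_{k+1}) − V(τ_k) ≤ 2δ' + L₁ t/n` through the isotropic value `R₁ := RhsA 𝟙 + KfunA 𝟙` (two grid
  events and [EnvA] at `A = 𝟙`); the total is `< δ`;
* the bridges `Mfun σ Φ ψ 0 = MfunA σ Φ (∇ψ)`, `Kfun … = KfunA …`, `Rhs … τ = RhsA … τ` (`τ ≤ t`) of …DefsE turn
  the target event into `{sup_τ |J − R| > δ}`, which is thus covered by the null complement of the good set
  (`localGibbsLaw_compl_good'`), the energy event, the dilute event and the `2(n+1)` grid events
  (`measure_le_of_imp3`, `measure_biUnion_finset_le`); squeeze.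
No new definitions, no named facts; axioms `propext`, `Classical.choice`, `Quot.sound`.
-/

namespace Summit.AtomisticToContinuum.HydrodynamicLimit.Theorems.HemisphereAffineSlaving

open scoped BigOperators Topology Classical ENNReal InnerProductSpace
open Filter Set Function MeasureTheory

noncomputable section

open Literature.MathematicalPhysics.KineticTheory (T3 V3)

/-- The dilute event is monotone in the level: a lower ceiling is a smaller event (local copy of
`DiluteAt.mono`, file …ChannelSplit, to keep the import closure small). [folklore] -/
private theorem diluteAt_mono_SF {σ : ℝ} {a₀ θ₀ : T3 → ℝ} {u₀ : T3 → V3} {Φ : Flows σ} {t : ℝ}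
    {φ : ℕ → T3 → ℝ} {η η' : ℝ} (h : DiluteAt σ a₀ θ₀ u₀ Φ t φ η) (hle : η ≤ η') :
    DiluteAt σ a₀ θ₀ u₀ Φ t φ η' := by
  refine tendsto_of_tendsto_of_tendsto_of_le_of_le tendsto_const_nhds h (fun _ => bot_le)
    (fun N => measure_mono ?_)
  rintro z ⟨s, hs, x, hx⟩
  exact ⟨s, hs, x, hle.trans_lt hx⟩

/-- A one-sided Lipschitz bound on `[0, t]` is a two-sided modulus `L h` at scale `h`. [folklore] -/
private theorem modulus_of_lipschitz_SF {t L h : ℝ} (hL : 0 ≤ L) (R : ℝ → ℝ)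
    (hR : ∀ τ τ' : ℝ, 0 ≤ τ → τ ≤ τ' → τ' ≤ t → |R τ' - R τ| ≤ L * (τ' - τ)) :
    ∀ τ ∈ Icc 0 t, ∀ τ' ∈ Icc 0 t, |τ' - τ| ≤ h → |R τ' - R τ| ≤ L * h := by
  intro a ha b hb hab
  rcases le_total a b with hab' | hba
  · calc |R b - R a| ≤ L * (b - a) := hR a b ha.1 hab' hb.2
      _ ≤ L * h := by
        refine mul_le_mul_of_nonneg_left ?_ hL
        rwa [abs_of_nonneg (sub_nonneg.2 hab')] at hab
  · rw [abs_sub_comm]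
    calc |R a - R b| ≤ L * (a - b) := hR b a hb.1 hba ha.2
      _ ≤ L * h := by
        refine mul_le_mul_of_nonneg_left ?_ hL
        rwa [abs_sub_comm, abs_of_nonneg (sub_nonneg.2 hba)] at hab

/-- DETERMINISTIC CORE of [SupA] (pure real analysis). If `V` is monotone on `[0, t]` and dominates the
increments of `J` with constant `C ≥ 0`, `R` and `R₁` are `L_ψ`- and `L₁`-Lipschitz on `[0, t]`, and at the
`n + 1` grid times `kt/n` both `|J − R| ≤ δ'` and `|V − R₁| ≤ δ'`, then
`sup_{τ ≤ t} |J(τ) − R(τ)| ≤ δ' + C (2δ' + L₁ t/n) + L_ψ t/n` (grid lemma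
`exists_grid_index_of_dominated_increments`, and `V(τ_{k+1}) − V(τ_k) ≤ 2δ' + L₁ t/n` through `R₁`); in
particular it is `< δ` under the stated budget. [folklore] -/
private theorem supBound_of_grid_SF {t C L₁ Lψ δ δ' : ℝ} {n : ℕ} (ht : 0 < t) (hn : 0 < n) (hC : 0 ≤ C)
    (hLψ : 0 ≤ Lψ) (J V R R₁ : ℝ → ℝ) (hV : MonotoneOn V (Icc 0 t))
    (hJ : ∀ τ τ' : ℝ, 0 ≤ τ → τ ≤ τ' → τ' ≤ t → |J τ' - J τ| ≤ C * (V τ' - V τ))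
    (hR : ∀ τ τ' : ℝ, 0 ≤ τ → τ ≤ τ' → τ' ≤ t → |R τ' - R τ| ≤ Lψ * (τ' - τ))
    (hR₁ : ∀ τ τ' : ℝ, 0 ≤ τ → τ ≤ τ' → τ' ≤ t → |R₁ τ' - R₁ τ| ≤ L₁ * (τ' - τ))
    (hgJ : ∀ k : ℕ, k < n + 1 → |J (k * (t / n)) - R (k * (t / n))| ≤ δ')
    (hgV : ∀ k : ℕ, k < n + 1 → |V (k * (t / n)) - R₁ (k * (t / n))| ≤ δ')
    (hbud : δ' + C * (2 * δ' + L₁ * (t / n)) + Lψ * (t / n) < δ) :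
    ∀ τ ∈ Icc 0 t, |J τ - R τ| < δ := by
  intro τ hτ
  have hn' : (0 : ℝ) < n := Nat.cast_pos.2 hn
  have hh : 0 < t / n := div_pos ht hn'
  obtain ⟨k, hk, hle⟩ := exists_grid_index_of_dominated_increments ht hn hC J V R hV hJ
    (modulus_of_lipschitz_SF hLψ R hR) τ hτ
  have h1 := hgJ k (by omega)
  have h2 := hgV k (by omega)
  have h3 := hgV (k + 1) (by omega)
  push_cast at h3
  have hk0 : 0 ≤ (k : ℝ) * (t / n) := mul_nonneg k.cast_nonneg hh.le
  have hkk : (k : ℝ) * (t / n) ≤ ((k : ℝ) + 1) * (t / n) :=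
    mul_le_mul_of_nonneg_right (by linarith) hh.le
  have hk1n : (k : ℝ) + 1 ≤ n := by exact_mod_cast Nat.succ_le_of_lt hk
  have hk1t : ((k : ℝ) + 1) * (t / n) ≤ t := by
    calc ((k : ℝ) + 1) * (t / n) ≤ n * (t / n) := mul_le_mul_of_nonneg_right hk1n hh.le
      _ = t := mul_div_cancel₀ t hn'.ne'
  have h4 := hR₁ _ _ hk0 hkk hk1t
  rw [show ((k : ℝ) + 1) * (t / n) - k * (t / n) = t / n by ring] at h4
  have hVinc : V (((k : ℝ) + 1) * (t / n)) - V (k * (t / n)) ≤ 2 * δ' + L₁ * (t / n) := by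
    have e2 := (abs_le.mp h2).1
    have e3 := (abs_le.mp h3).2
    have e4 := (abs_le.mp h4).2
    linarith
  have hCV : C * (V (((k : ℝ) + 1) * (t / n)) - V (k * (t / n))) ≤ C * (2 * δ' + L₁ * (t / n)) :=
    mul_le_mul_of_nonneg_left hVinc hC
  linarith

/-- **Registered stub [SupA] `stub_collisionalStressLaw_of_fixedA` (line hemisphere-affine-slaving, crux
`CollisionalTransferLocality`, stmt-AtomisticToContinuum-9518): THE `sup_τ` MOMENTUM LAW [Kσ] FROM THE
FIXED-TIME LAWS.** [KσA] ∧ [EnvA] ∧ [DomA] ⟹ `CollisionalStressLaw`. With `σ₀ := min σ_A (1/2)` and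
`η₁ := min η_A η_Z` ([Z] `stub_hsCompressibility_linear`): the bridges of …DefsE rewrite the event as
`{sup_τ |MfunA(∇ψ) − (RhsA + KfunA)(∇ψ)| > δ}`; on a good orbit below the energy cap `E₀` ([E]
`stub_energyAllTimes`) and the dilute ceiling, [DomA] (monotone isotropic mark sum dominating the increments,
constant `9 C_ψ`, `C_ψ` from `exists_grad_bound`) and [EnvA] (moduli `L_ψ t/n`, `L₁ t/n`) feed the grid lemma
`exists_grid_index_of_dominated_increments`, whose window increment `V(τ_{k+1}) − V(τ_k)` is `≤ 2δ' + L₁ t/n`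
by the isotropic fixed-time law at the two grid ends; [KσA] at `A = ∇ψ` and `A = 𝟙` on the grid `kt/n`,
`k ≤ n`, gives `2(n+1)` events of probability `→ 0`; union bound off the null bad set
(`localGibbsLaw_compl_good'`, `measure_le_of_imp3`) and squeeze. [folklore] -/
theorem stub_collisionalStressLaw_of_fixedA : (∀ (a₀ θ₀ : T3 → ℝ) (u₀ : T3 → V3), NiceProfiles a₀ θ₀ u₀ → ∃ σ₀ : ℝ, 0 < σ₀ ∧ ∃ η₁ : ℝ, 0 < η₁ ∧ ∀ σ : ℝ, 0 < σ → σ < σ₀ → ∀ (Φ : Flows σ) (t : ℝ), 0 < t → VirialBounded σ a₀ θ₀ u₀ Φ t → ∀ (γ C : ℝ) (φ : ℕ → T3 → ℝ), 0 < γ → γ ≤ 1 / 15 → AdmissibleKernel γ C φ → DiluteAt σ a₀ θ₀ u₀ Φ t φ η₁ → ∀ (A : ℝ → T3 → Fin 3 → Fin 3 → ℝ), SmoothMatrixOn (Icc 0 t) A → StressLawFixedAAt σ a₀ θ₀ u₀ Φ φ t A) → (∀ (σ K ηZ η₁ CA E₀ : ℝ), 0 < σ → 0 ≤ K → 0 <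 η₁ → η₁ ≤ ηZ → 0 ≤ CA → 0 ≤ E₀ → (∀ η : ℝ, 0 ≤ η → η ≤ ηZ → |Literature.MathematicalPhysics.KineticTheory.hsCompressibility η - 1| ≤ K * η) → ∃ L : ℝ, 0 ≤ L ∧ ∀ (γ C : ℝ) (φ : ℕ → T3 → ℝ), AdmissibleKernel γ C φ → ∀ (Φ : Flows σ) (N : ℕ) (z : Cfg N), z ∈ (Φ N).good → ((N : ℝ) + 1)⁻¹ * Literature.Analysis.FluidPDE.configEnergy z ≤ E₀ → ∀ (t : ℝ) (A : ℝ → T3 → Fin 3 → Fin 3 → ℝ), 0 < t → SmoothMatrixOn (Icc 0 t) A → (∀ s ∈ Icc 0 t, ∀ (x : T3) (a b : Fin 3), |A s x a b| ≤ CA) → (∀ s ∈ Icc 0 t, ∀ x : T3, rhoB φ N ((Φ N).flow s z) x * σ ^ 3 ≤ η₁) → ∀ τ τ' : ℝ, 0 ≤ τ → τ ≤ τ' → τ' ≤ t → |RhsA σ Φ φ A N z τ' - RhsA σ Φ φ A N z τ| + |KfunA σ Φ φ A N z τ' - KfunA σ Φ φ A N z τ| ≤ L * (τ' - τ)) → (∀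 (σ : ℝ), 0 < σ → σ ≤ 1 / 2 → ∀ (Φ : Flows σ) (N : ℕ) (z : Cfg N), z ∈ (Φ N).good → ∀ (t CA : ℝ) (A : ℝ → T3 → Fin 3 → Fin 3 → ℝ), 0 ≤ CA → (∀ s ∈ Icc 0 t, ∀ (x : T3) (a b : Fin 3), |A s x a b| ≤ CA) → ∀ τ τ' : ℝ, 0 ≤ τ → τ ≤ τ' → τ' ≤ t → MfunA σ Φ isoW N z τ ≤ MfunA σ Φ isoW N z τ' ∧ |MfunA σ Φ A N z τ' - MfunA σ Φ A N z τ| ≤ 9 * CA * (MfunA σ Φ isoW N z τ' - MfunA σ Φ isoW N z τ)) → CollisionalStressLaw := by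
  intro hA hEnv hDom a₀ θ₀ u₀ hP
  obtain ⟨ηZ, hηZ, K, hK0, hZK⟩ := stub_hsCompressibility_linear
  obtain ⟨σA, hσA, ηA, hηA, HA⟩ := hA a₀ θ₀ u₀ hP
  refine ⟨min σA (1 / 2), lt_min hσA (by norm_num), min ηA ηZ, lt_min hηA hηZ, ?_⟩
  intro σ hσ hlt Φ t ht hV γ C φ hγ hγ' hadm hDil ψ hψ δ hδ
  have hltA : σ < σA := lt_of_lt_of_le hlt (min_le_left _ _)
  have hhalf : σ ≤ 1 / 2 := (lt_of_lt_of_le hlt (min_le_right _ _)).le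
  have hη₁ : 0 < min ηA ηZ := lt_min hηA hηZ
  -- the energy cap, the gradient bound, the two Lipschitz constants
  obtain ⟨E₀, hE₀, HE⟩ := stub_energyAllTimes a₀ θ₀ u₀ hP σ hσ hhalf Φ
  obtain ⟨Cψ, hCψ0, hCψ, -⟩ := exists_grad_bound ht hψ
    (Literature.Analysis.FunctionSpaces.Torus.isSmoothSpaceTimeOn_const
      (Literature.Analysis.FunctionSpaces.Torus.isSmooth_const (0 : ℝ)) _)
  obtain ⟨Lψ, hLψ0, HLψ⟩ :=
    hEnv σ K ηZ (min ηA ηZ) Cψ E₀ hσ hK0 hη₁ (min_le_right _ _) hCψ0 hE₀ hZK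
  obtain ⟨L₁, hL₁0, HL₁⟩ :=
    hEnv σ K ηZ (min ηA ηZ) 1 E₀ hσ hK0 hη₁ (min_le_right _ _) zero_le_one hE₀ hZK
  -- the fixed-time laws at `A = ∇ψ` and `A = 𝟙`
  have hDilA : DiluteAt σ a₀ θ₀ u₀ Φ t φ ηA := diluteAt_mono_SF hDil (min_le_left _ _)
  have HAψ : StressLawFixedAAt σ a₀ θ₀ u₀ Φ φ t (gradPsi ψ) :=
    HA σ hσ hltA Φ t ht hV γ C φ hγ hγ' hadm hDilA (gradPsi ψ) (smoothMatrixOn_gradPsi ht hψ)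
  have HA1 : StressLawFixedAAt σ a₀ θ₀ u₀ Φ φ t isoW :=
    HA σ hσ hltA Φ t ht hV γ C φ hγ hγ' hadm hDilA isoW (smoothMatrixOn_isoW _)
  -- grid size `n` and accuracy `δ'`
  have hC9 : 0 ≤ 9 * Cψ := by positivity
  obtain ⟨n, hn⟩ := exists_nat_gt (4 * (9 * Cψ * L₁ + Lψ) * t / δ)
  have hnR : (0 : ℝ) < n := lt_of_le_of_lt (by positivity) hn
  have hn0 : 0 < n := by exact_mod_cast hnR
  obtain ⟨δ', hδ'⟩ : ∃ δ' : ℝ, δ' = δ / (4 * (1 + 18 * Cψ)) := ⟨_, rfl⟩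
  have hδ'0 : 0 < δ' := by rw [hδ']; positivity
  have hbud : δ' + 9 * Cψ * (2 * δ' + L₁ * (t / n)) + Lψ * (t / n) < δ := by
    have hkey : δ' * (4 * (1 + 18 * Cψ)) = δ := by
      rw [hδ']; exact div_mul_cancel₀ δ (by positivity)
    have h4 : 4 * (9 * Cψ * L₁ + Lψ) * t < n * δ := (div_lt_iff₀ hδ).1 hn
    have hmesh : (9 * Cψ * L₁ + Lψ) * (t / n) < δ / 4 := by
      rw [lt_div_iff₀ (by norm_num : (0 : ℝ) < 4),
        show (9 * Cψ * L₁ + Lψ) * (t / n) * 4 = 4 * (9 * Cψ * L₁ + Lψ) * t / n by ring,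
        div_lt_iff₀ hnR]
      linarith [mul_comm (n : ℝ) δ]
    nlinarith [hkey, hmesh, hδ'0, hCψ0]
  have hgrid : ∀ k : ℕ, k < n + 1 → (k : ℝ) * (t / n) ∈ Icc 0 t := by
    intro k hk
    refine ⟨by positivity, ?_⟩
    have hk' : (k : ℝ) ≤ n := by exact_mod_cast Nat.lt_succ_iff.mp hk
    calc (k : ℝ) * (t / n) ≤ n * (t / n) := by gcongr
      _ = t := mul_div_cancel₀ t hnR.ne'
  -- the laws and the bad events
  set P : (N : ℕ) → Measure (Cfg N) := fun N =>
    Literature.MathematicalPhysics.KineticTheory.localGibbsLaw σ a₀ u₀ θ₀ N (Φ N) with hP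
  set W : (N : ℕ) → Set (Cfg N) := fun N =>
    {z | ∃ s ∈ Icc 0 t, E₀ < ((N : ℝ) + 1)⁻¹ * Literature.Analysis.FluidPDE.configEnergy ((Φ N).flow s z)}
    with hWdef
  set D : (N : ℕ) → Set (Cfg N) := fun N =>
    {z | ∃ s ∈ Icc 0 t, ∃ x : T3, min ηA ηZ < rhoB φ N ((Φ N).flow s z) x * σ ^ 3} with hDdef
  set Fψ : (N : ℕ) → ℕ → Set (Cfg N) := fun N k =>
    {z | δ' < |MfunA σ Φ (gradPsi ψ) N z (k * (t / n)) -
      (RhsA σ Φ φ (gradPsi ψ) N z (k * (t / n)) + KfunA σ Φ φ (gradPsi ψ) N z (k * (t / n)))|}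
    with hFψdef
  set F1 : (N : ℕ) → ℕ → Set (Cfg N) := fun N k =>
    {z | δ' < |MfunA σ Φ isoW N z (k * (t / n)) -
      (RhsA σ Φ φ isoW N z (k * (t / n)) + KfunA σ Φ φ isoW N z (k * (t / n)))|}
    with hF1def
  have hWlim : Tendsto (fun N => P N (W N)) atTop (𝓝 0) := HE t
  have hDlim : Tendsto (fun N => P N (D N)) atTop (𝓝 0) := hDil
  have hFlim : Tendsto (fun N => ∑ k ∈ Finset.range (n + 1), (P N (Fψ N k) + P N (F1 N k))) atTop
      (𝓝 0) := by
    have h := tendsto_finsetSum (f := fun k N => P N (Fψ N k) + P N (F1 N k))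
      (a := fun _ => (0 : ℝ≥0∞)) (Finset.range (n + 1)) fun k hk => by
        have hkt : (k : ℝ) * (t / n) ∈ Icc 0 t := hgrid k (Finset.mem_range.1 hk)
        simpa using (HAψ _ hkt δ' hδ'0).add (HA1 _ hkt δ' hδ'0)
    simpa using h
  have hlim : Tendsto (fun N => P N (W N) + (P N (D N) +
      ∑ k ∈ Finset.range (n + 1), (P N (Fψ N k) + P N (F1 N k)))) atTop (𝓝 0) := by
    simpa using hWlim.add (hDlim.add hFlim)
  -- the deterministic core on a good orbit off the bad events
  have hcore : ∀ N : ℕ, ∀ z ∈ {z : Cfg N | ∃ τ ∈ Icc 0 t,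
      δ < |Mfun σ Φ ψ (fun (_ : ℝ) (_ : T3) => (0 : ℝ)) N z τ -
        (Rhs σ Φ φ ψ (fun (_ : ℝ) (_ : T3) => (0 : ℝ)) N z τ +
          Kfun σ Φ φ ψ (fun (_ : ℝ) (_ : T3) => (0 : ℝ)) N z τ)|},
      z ∈ (Φ N).good → z ∉ W N → z ∉ D N → z ∈ ⋃ k ∈ Finset.range (n + 1), (Fψ N k ∪ F1 N k) := by
    rintro N z ⟨τ, hτ, hzδ⟩ hz hzW hzD
    rw [Mfun_zero_eq_MfunA, Kfun_zero_eq_KfunA, Rhs_zero_eq_RhsA hψ σ Φ φ N z hτ.2] at hzδ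
    by_contra hzF
    simp only [Set.mem_iUnion, Set.mem_union, exists_prop, Finset.mem_range, hFψdef, hF1def,
      Set.mem_setOf_eq, not_exists, not_and, not_or, not_lt] at hzF
    simp only [hWdef, Set.mem_setOf_eq, not_exists, not_and, not_lt] at hzW
    simp only [hDdef, Set.mem_setOf_eq, not_exists, not_and, not_lt] at hzD
    -- energy and dilute information on this orbit
    have hEz : ((N : ℝ) + 1)⁻¹ * Literature.Analysis.FluidPDE.configEnergy z ≤ E₀ := by
      have h0 := hzW 0 ⟨le_rfl, ht.le⟩
      rwa [configEnergy_orbit Φ hz 0] at h0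
    have hρz : ∀ s ∈ Icc 0 t, ∀ x : T3, rhoB φ N ((Φ N).flow s z) x * σ ^ 3 ≤ min ηA ηZ :=
      fun s hs x => hzD s hs x
    have hiso : ∀ s ∈ Icc 0 t, ∀ (x : T3) (a b : Fin 3), |isoW s x a b| ≤ 1 := by
      intro s _ x a b
      simp only [isoW]
      split_ifs <;> simp
    -- the inputs of the core
    have hmono : MonotoneOn (MfunA σ Φ isoW N z) (Icc 0 t) := fun a ha b hb hab =>
      (hDom σ hσ hhalf Φ N z hz t Cψ (gradPsi ψ) hCψ0 hCψ a b ha.1 hab hb.2).1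
    have hJ : ∀ τ τ' : ℝ, 0 ≤ τ → τ ≤ τ' → τ' ≤ t →
        |MfunA σ Φ (gradPsi ψ) N z τ' - MfunA σ Φ (gradPsi ψ) N z τ| ≤
          9 * Cψ * (MfunA σ Φ isoW N z τ' - MfunA σ Φ isoW N z τ) := fun τ τ' h0 h1 h2 =>
      (hDom σ hσ hhalf Φ N z hz t Cψ (gradPsi ψ) hCψ0 hCψ τ τ' h0 h1 h2).2
    have hR : ∀ τ τ' : ℝ, 0 ≤ τ → τ ≤ τ' → τ' ≤ t →
        |RhsA σ Φ φ (gradPsi ψ) N z τ' + KfunA σ Φ φ (gradPsi ψ) N z τ' -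
          (RhsA σ Φ φ (gradPsi ψ) N z τ + KfunA σ Φ φ (gradPsi ψ) N z τ)| ≤ Lψ * (τ' - τ) := by
      intro τ τ' h0 h1 h2
      have h := HLψ γ C φ hadm Φ N z hz hEz t (gradPsi ψ) ht (smoothMatrixOn_gradPsi ht hψ) hCψ hρz
        τ τ' h0 h1 h2
      calc _ = |(RhsA σ Φ φ (gradPsi ψ) N z τ' - RhsA σ Φ φ (gradPsi ψ) N z τ) +
            (KfunA σ Φ φ (gradPsi ψ) N z τ' - KfunA σ Φ φ (gradPsi ψ) N z τ)| := by ring_nf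
        _ ≤ _ := abs_add_le _ _
        _ ≤ _ := h
    have hR1 : ∀ τ τ' : ℝ, 0 ≤ τ → τ ≤ τ' → τ' ≤ t →
        |RhsA σ Φ φ isoW N z τ' + KfunA σ Φ φ isoW N z τ' -
          (RhsA σ Φ φ isoW N z τ + KfunA σ Φ φ isoW N z τ)| ≤ L₁ * (τ' - τ) := by
      intro τ τ' h0 h1 h2
      have h := HL₁ γ C φ hadm Φ N z hz hEz t isoW ht (smoothMatrixOn_isoW _) hiso hρz τ τ' h0 h1 h2
      calc _ = |(RhsA σ Φ φ isoW N z τ' - RhsA σ Φ φ isoW N z τ) +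
            (KfunA σ Φ φ isoW N z τ' - KfunA σ Φ φ isoW N z τ)| := by ring_nf
        _ ≤ _ := abs_add_le _ _
        _ ≤ _ := h
    have hlt' := supBound_of_grid_SF ht hn0 hC9 hLψ0 (MfunA σ Φ (gradPsi ψ) N z) (MfunA σ Φ isoW N z)
      (fun τ => RhsA σ Φ φ (gradPsi ψ) N z τ + KfunA σ Φ φ (gradPsi ψ) N z τ)
      (fun τ => RhsA σ Φ φ isoW N z τ + KfunA σ Φ φ isoW N z τ) hmono hJ hR hR1
      (fun k hk => (hzF k hk).1) (fun k hk => (hzF k hk).2) hbud τ hτ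
    exact lt_asymm hzδ hlt'
  -- union bound and squeeze
  refine tendsto_of_tendsto_of_tendsto_of_le_of_le tendsto_const_nhds hlim (fun _ => bot_le) fun N => ?_
  have hG : P N (Φ N).goodᶜ = 0 := by rw [hP]; exact localGibbsLaw_compl_good' (Φ N)
  refine (measure_le_of_imp3 (P N) hG (hcore N)).trans ?_
  refine add_le_add le_rfl (add_le_add le_rfl ?_)
  exact (measure_biUnion_finset_le _ _).trans (Finset.sum_le_sum fun k _ => measure_union_le _ _)

end

end Summit.AtomisticToContinuum.HydrodynamicLimit.Theorems.HemisphereAffineSlaving
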